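import Summits.HodgeConjecture.HodgeConjecture.Theorems.MarkmanPartnerTransportIsometrySpannedThirdSelfAdjointScalar

/-!
# Route MarkmanPartnerTransport · support #3 `IsometrySpannedThird` AT EVERY PICARD RANK, partner-free,
# MODULO ONE GEOMETRIC INPUT: algebraic "graph classes" `c_g ∈ A²(X)` with cubic form
# `t·q(y,w) + q(gy,w) + q(gw,y)` for the rational Hodge isometries `g` of `H²(X)`

The partner-free method of `…IsometrySpannedThirdScalarAllRanks` (class endomorphism `F_c`, transcendental
projector `π_T`, `q`-orthogonal bases of `N¹(X)`, polarised Fujiki, O'Grady's `q^∨`, Verbitsky–Guan uniqueness)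
is run under the route's FULL hypothesis `SpannedByIsometries X φ` (`π_T F_c π_T = Σ cᵢ gᵢ` on `T(X)`,
`gᵢ` bijective rational Hodge `q`-isometries of `H²(X)`), isolating the single algebro-geometric input the
isometry third needs below Picard rank `4` (where no K3 partner exists): for every such `g`, an algebraic class
`c_g ∈ A²(X)` and `t ∈ ℂ` with `(c_g ∪ y) ∪ w = (t·q(y,w) + q(gy,w) + q(gw,y))·P` (hypothesis `hGraph`). Then
`q(F_c y, w) = Σ ½cᵢ (q(gᵢy,w) + q(gᵢw,y)) + β(y_N, w_N)` with `β` symmetric bilinear on `N¹(X)` (`gᵢ` preserve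
`N¹(X)` by Lefschetz `(1,1)`, and `T ⟂ N¹`), so `c = Σ ½cᵢ·c_{gᵢ} + c'` with `c'` from
`exists_algebraicClass_of_symmetricForm` — algebraic.

The intended source of `hGraph` (NOT in the tree): `c_g = Δ^*(Γ_g ∘ Q_X)` for Markman's algebraic graph class
`Γ_g` (Markman 2024 Thm. 1.1) and the Beauville–Bogomolov tensor `Q_X = q⁻¹ ∈ H²⊗H² ⊂ H⁴(X × X; ℚ)`, algebraic
for projective `K3^{[n]}`-type (Charles–Markman 2013, Lefschetz standard conjecture); `tr g` is the `t`.

* `classEndomorphism_transcendentalPart` — block form of `F_c` w.r.t. `H² = N¹ ⊕ T` for a given projector;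
* `mem_algebraicClasses_two_of_spannedByIsometries_of_graphClasses`,
  `hodgeConjectureFor_of_spannedByIsometries_of_graphClasses` — **marked `X` + `SpannedByIsometries X φ` +
  `hGraph` ⇒ HC⁴(X)**, every Picard rank, modulo {`VerbitskyGuan_cohomology_K3HilbertSquareType`,
  `OGrady2008_dualBBFClass_algebraic`, `Voisin2003_cupProduct_algebraicClasses`}.

No definition, no sorry. References: E. Markman, Compos. Math. 160 (2024) Thm. 1.1; F. Charles and E. Markman,
Compos. Math. 149 (2013) Thm. 1.1; Yu. Zarhin, J. reine angew. Math. 341 (1983) Thm. 1.5.1; S. Novario, Kyoto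
J. Math. 66 (2026) Thm. 6.2.
-/

noncomputable section

set_option linter.dupNamespace false

open Module CategoryTheory
open Literature.AlgebraicTopology.SingularHomology Literature.Geometry.Kaehler
open Literature.AlgebraicGeometry Literature.AlgebraicGeometry.Motives Literature.AlgebraicGeometry.HodgeTheory
open Literature.AlgebraicGeometry.Hyperkaehler Literature.AlgebraicGeometry.Surfaces
open Summit.HodgeConjecture.HodgeConjecture.Theorems.NikulinTwinTransport
open Summit.HodgeConjecture.HodgeConjecture.Theorems.MarkmanPartnerTransport.BBFPositivity

namespace Summit.HodgeConjecture.HodgeConjecture.Theorems.MarkmanPartnerTransport.PartnerLattice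

/-- `MarkedK3Sq[X, φ, P, z]`: VERBATIM the `let MarkedK3Sq := …` binder of the route declarations of
MarkmanPartnerTransport (clauses (m1)–(m6)). Local notation only. -/
local notation3 (prettyPrint := false) "MarkedK3Sq[" X ", " φ ", " P ", " z "]" =>
  (((IsIntegralClass P ∧ ∀ Q : complexBetti X (2 * 4), IsIntegralClass Q → ∃ n : ℤ, Q = n • P) ∧
    (∀ c : complexBetti X 2, IsIntegralClass c ↔ ∃ v : K3HilbertIndex → ℤ, φ c = fun i => (v i : ℂ)) ∧
    (∀ a : complexBetti X 2, cupPowTwo a 4 = ((3 : ℂ) * (k3HilbertForm 2 (φ a) (φ a)) ^ 2) • P) ∧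
    (IsOfHodgeType 4 X 2 2 0 (LinearEquiv.symm φ z) ∧
      ∀ τ : complexBetti X 2, IsOfHodgeType 4 X 2 2 0 τ → ∃ t : ℂ, τ = t • LinearEquiv.symm φ z) ∧
    (∀ c : complexBetti X 2, IsOfHodgeType 4 X 2 1 1 c ↔
      (k3HilbertForm 2 (φ c) z = 0 ∧ k3HilbertForm 2 (φ c) (star z) = 0)) ∧
    (k3HilbertForm 2 z z = 0 ∧ 0 < (k3HilbertForm 2 (star z) z).re)))

/-- `Cup3[c, y, w] = (c ∪ y) ∪ w ∈ H⁸` for `c ∈ H⁴`, `y, w ∈ H²`. Local notation only. -/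
local notation3 (prettyPrint := false) "Cup3[" c ", " y ", " w "]" =>
  cupProduct (rfl : 2 * 3 + 2 = 2 * 4) (cupProduct (rfl : 2 * 2 + 2 = 2 * 3) c y) w

variable {X : SchemeOver ℂ} {φ : complexBetti X 2 ≃ₗ[ℂ] (K3HilbertIndex → ℂ)} {P : complexBetti X (2 * 4)}
  {z : K3HilbertIndex → ℂ}

/-- `SpannedByIso[X, φ]`: VERBATIM the `let SpannedByIsometries := …` binder of the route declarations (with
`IsBBFTransc` inlined). Local notation only. -/
local notation3 (prettyPrint := false) "SpannedByIso[" X ", " φ "]" =>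
  ∀ f : complexBetti X 2 →ₗ[ℂ] complexBetti X 2, (∀ y, IsRationalClass y → IsRationalClass (f y)) →
    (∀ (i j : ℕ) y, IsOfHodgeType 4 X 2 i j y → IsOfHodgeType 4 X 2 i j (f y)) →
    (∀ d : complexBetti X 2, d ∈ algebraicClasses X 1 → f d = 0) →
    (∀ y : complexBetti X 2, ∀ d : complexBetti X 2, d ∈ algebraicClasses X 1 →
      k3HilbertForm 2 (φ (f y)) (φ d) = 0) →
    ∃ (k : ℕ) (c : Fin k → ℚ) (g : Fin k → (complexBetti X 2 →ₗ[ℂ] complexBetti X 2)),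
      (∀ i, Function.Bijective (g i) ∧ (∀ y, IsRationalClass y → IsRationalClass (g i y)) ∧
        (∀ (a b : ℕ) y, IsOfHodgeType 4 X 2 a b y → IsOfHodgeType 4 X 2 a b (g i y)) ∧
        (∀ a b, k3HilbertForm 2 (φ (g i a)) (φ (g i b)) = k3HilbertForm 2 (φ a) (φ b))) ∧
      ∀ y : complexBetti X 2, (∀ d : complexBetti X 2, d ∈ algebraicClasses X 1 →
        k3HilbertForm 2 (φ y) (φ d) = 0) → f y = ∑ i : Fin k, ((c i : ℂ) • g i y)

/-- `Graph[X, φ, P]`: the geometric input — for every bijective rational Hodge `q`-isometry `g` of `H²(X)` an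
ALGEBRAIC class `c_g ∈ A²(X)` and `t ∈ ℂ` with `(c_g ∪ y) ∪ w = (t·q(y,w) + q(gy,w) + q(gw,y))·P`
(intended: `c_g = Δ^*(Γ_g ∘ q⁻¹)`, `t = tr g`; Markman 2024 + Charles–Markman 2013). Local notation only. -/
local notation3 (prettyPrint := false) "Graph[" X ", " φ ", " P "]" =>
  ∀ g : complexBetti X 2 →ₗ[ℂ] complexBetti X 2, Function.Bijective g →
    (∀ y, IsRationalClass y → IsRationalClass (g y)) →
    (∀ (a b : ℕ) y, IsOfHodgeType 4 X 2 a b y → IsOfHodgeType 4 X 2 a b (g y)) →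
    (∀ a b, k3HilbertForm 2 (φ (g a)) (φ (g b)) = k3HilbertForm 2 (φ a) (φ b)) →
    ∃ cg ∈ algebraicClasses X 2, ∃ t : ℂ, ∀ y w : complexBetti X 2,
      Cup3[cg, y, w] = (t * k3HilbertForm 2 (φ y) (φ w) + k3HilbertForm 2 (φ (g y)) (φ w) +
        k3HilbertForm 2 (φ (g w)) (φ y)) • P

/-- **Block form of the class endomorphism for a given transcendental projector.** For a rational `(2,2)`-class
`c` with endomorphism `F` (`(c ∪ y) ∪ w = q(φ F y, φ w)·P`) and a projector `π_T` with the clauses of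
`exists_transcendentalProjector`: `f := π_T F π_T` is rational, Hodge, kills `N¹(X)`, has transcendental image,
is `q`-self-adjoint, and `q(F y, w) = q(f y, w) + q(F y_N, w_N)` with `y_N = y − π_T y ∈ N¹(X)` (the cross terms
die: `π_T F` kills `N¹(X)` by Lefschetz `(1,1)` and the non-degeneracy of `q` on `N¹`).
[cite: Zarhin1983HodgeGroupsK3, Thm. 1.5.1] [cite: Novario2026HodgeClassesHilbertSquares, Thm. 6.2] -/
theorem classEndomorphism_transcendentalPart (hX : IsSmoothProjective 4 X) (hM : MarkedK3Sq[X, φ, P, z])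
    {c : complexBetti X (2 * 2)} (hcrat : IsRationalClass c) (hc22 : IsOfHodgeType 4 X (2 * 2) 2 2 c)
    {F : complexBetti X 2 →ₗ[ℂ] complexBetti X 2}
    (hF : ∀ y w : complexBetti X 2, Cup3[c, y, w] = (k3HilbertForm 2 (φ (F y)) (φ w)) • P)
    {πT : complexBetti X 2 →ₗ[ℂ] complexBetti X 2} (hT1 : ∀ d ∈ algebraicClasses X 1, πT d = 0)
    (hT3 : ∀ y : complexBetti X 2, ∀ d ∈ algebraicClasses X 1, k3HilbertForm 2 (φ (πT y)) (φ d) = 0)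
    (hT4 : ∀ y : complexBetti X 2, y - πT y ∈ algebraicClasses X 1)
    (hT5 : ∀ y, IsRationalClass y → IsRationalClass (πT y))
    (hT6 : ∀ y w, k3HilbertForm 2 (φ (πT y)) (φ w) = k3HilbertForm 2 (φ y) (φ (πT w)))
    (hT7 : ∀ (i j : ℕ) y, IsOfHodgeType 4 X 2 i j y → IsOfHodgeType 4 X 2 i j (πT y)) :
    (∀ y, IsRationalClass y → IsRationalClass (πT (F (πT y)))) ∧
    (∀ (i j : ℕ) y, IsOfHodgeType 4 X 2 i j y → IsOfHodgeType 4 X 2 i j (πT (F (πT y)))) ∧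
    (∀ d ∈ algebraicClasses X 1, πT (F (πT d)) = 0) ∧
    (∀ y : complexBetti X 2, ∀ d ∈ algebraicClasses X 1, k3HilbertForm 2 (φ (πT (F (πT y)))) (φ d) = 0) ∧
    (∀ y w, k3HilbertForm 2 (φ (πT (F (πT y)))) (φ w) = k3HilbertForm 2 (φ y) (φ (πT (F (πT w))))) ∧
    ∀ y w, k3HilbertForm 2 (φ (F y)) (φ w) =
      k3HilbertForm 2 (φ (πT (F (πT y)))) (φ w) + k3HilbertForm 2 (φ (F (y - πT y))) (φ (w - πT w)) := by
  classical
  have hFrat : ∀ y, IsRationalClass y → IsRationalClass (F y) :=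
    fun y hy => isRationalClass_classEndomorphism hX hM hF hcrat hy
  have hFh : ∀ (i j : ℕ) y, IsOfHodgeType 4 X 2 i j y → IsOfHodgeType 4 X 2 i j (F y) :=
    fun i j y hy => isOfHodgeType_classEndomorphism hX hM hF hc22 hy
  have hFadj : ∀ y w, k3HilbertForm 2 (φ (F y)) (φ w) = k3HilbertForm 2 (φ y) (φ (F w)) :=
    classEndomorphism_selfAdjoint hX hM hF
  have hN11 : ∀ d ∈ algebraicClasses X 1, IsOfHodgeType 4 X 2 1 1 d := fun d hd =>
    isOfHodgeType_of_mem_algebraicClasses_of_isSmoothProjective hX 1 hd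
  -- Claim A: `πT (F d) = 0` for `d ∈ N¹(X)`
  have hA : ∀ d ∈ algebraicClasses X 1, πT (F d) = 0 := by
    have hspan := supportedClasses_eq_span_isRationalClass hX 2 1
    change algebraicClasses X 1 = Submodule.span ℂ
      {c : complexBetti X 2 | IsRationalClass c ∧ c ∈ algebraicClasses X 1} at hspan
    intro d hd
    rw [hspan] at hd
    have hle : Submodule.span ℂ {c : complexBetti X 2 | IsRationalClass c ∧ c ∈ algebraicClasses X 1} ≤
        LinearMap.ker (πT ∘ₗ F) := by
      refine Submodule.span_le.2 ?_
      rintro d ⟨hdrat, hdalg⟩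
      rw [SetLike.mem_coe, LinearMap.mem_ker, LinearMap.comp_apply]
      have hu_alg : πT (F d) ∈ algebraicClasses X 1 :=
        lefschetzOneOne_rational_holds hX _ (hT5 _ (hFrat _ hdrat)) (hT7 1 1 _ (hFh 1 1 _ (hN11 d hdalg)))
      exact k3HilbertForm_radical_algebraicClasses_one_eq_zero hX hM hu_alg (hT3 (F d))
    simpa only [LinearMap.mem_ker, LinearMap.comp_apply] using hle hd
  refine ⟨fun y hy => hT5 _ (hFrat _ (hT5 _ hy)), fun i j y hy => hT7 i j _ (hFh i j _ (hT7 i j _ hy)),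
    fun d hd => by rw [hT1 d hd, map_zero, map_zero], fun y d hd => hT3 _ d hd,
    fun y w => by rw [hT6, hFadj, hT6], fun y w => ?_⟩
  have hy : y = (y - πT y) + πT y := by abel
  have hw : w = (w - πT w) + πT w := by abel
  have h2 : k3HilbertForm 2 (φ (F (y - πT y))) (φ (πT w)) = 0 := by
    rw [← hT6, hA _ (hT4 y), map_zero, k3HilbertForm_apply]; simp
  have h3 : k3HilbertForm 2 (φ (F (πT y))) (φ (w - πT w)) = 0 := by
    rw [hFadj, k3HilbertForm_comm, ← hT6, hA _ (hT4 w), map_zero, k3HilbertForm_comm, k3HilbertForm_apply]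
    simp
  have lhs1 : k3HilbertForm 2 (φ (F y)) (φ w) =
      k3HilbertForm 2 (φ (F (y - πT y))) (φ w) + k3HilbertForm 2 (φ (πT (F (πT y)))) (φ w) := by
    conv_lhs => rw [hy, map_add, map_add, k3HilbertForm_add_left]
    congr 1
    conv_lhs => rw [hw, map_add, k3HilbertForm_add_right, h3, zero_add, ← hT6]
  have lhs2 : k3HilbertForm 2 (φ (F (y - πT y))) (φ w) =
      k3HilbertForm 2 (φ (F (y - πT y))) (φ (w - πT w)) := by
    conv_lhs => rw [hw, map_add, k3HilbertForm_add_right, h2, add_zero]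
  rw [lhs1, lhs2, add_comm]

/-- **The isometry third at every Picard rank, modulo the graph classes** (module docstring): a rational
`(2,2)`-class `c` on a marked smooth projective `K3^{[2]}`-type fourfold with `SpannedByIsometries X φ` is
algebraic, given `Graph[X, φ, P]`. [cite: Markman2024, §1.1 Thm. 1.1] [cite: Zarhin1983HodgeGroupsK3, Thm. 1.5.1]
[cite: Novario2026HodgeClassesHilbertSquares, Thm. 6.2] [cite: OGrady2008NumericalK3Square, §3] -/
theorem mem_algebraicClasses_two_of_spannedByIsometries_of_graphClasses
    (hV : VerbitskyGuan_cohomology_K3HilbertSquareType) (hO : OGrady2008_dualBBFClass_algebraic)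
    (hcup : Voisin2003_cupProduct_algebraicClasses)
    (hX : IsSmoothProjective 4 X) (hK : IsOfK3HilbertSquareType X) (hM : MarkedK3Sq[X, φ, P, z])
    (hSp : SpannedByIso[X, φ]) (hGraph : Graph[X, φ, P]) {c : complexBetti X (2 * 2)}
    (hcrat : IsRationalClass c) (hc22 : IsOfHodgeType 4 X (2 * 2) 2 2 c) : c ∈ algebraicClasses X 2 := by
  classical
  obtain ⟨F, hF⟩ := exists_classEndomorphism hX hM c
  have hFadj : ∀ y w, k3HilbertForm 2 (φ (F y)) (φ w) = k3HilbertForm 2 (φ y) (φ (F w)) :=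
    classEndomorphism_selfAdjoint hX hM hF
  obtain ⟨πT, hT1, hT2, hT3, hT4, hT5, hT6, hT7⟩ := exists_transcendentalProjector hX hM
  obtain ⟨hfrat, hfh, hfN, hfT, hfadj, hsplitF⟩ :=
    classEndomorphism_transcendentalPart hX hM hcrat hc22 hF hT1 hT3 hT4 hT5 hT6 hT7
  have hNT : ∀ n ∈ algebraicClasses X 1, ∀ w, k3HilbertForm 2 (φ n) (φ (πT w)) = 0 := fun n hn w => by
    rw [k3HilbertForm_comm]; exact hT3 w n hn
  have hN11 : ∀ d ∈ algebraicClasses X 1, IsOfHodgeType 4 X 2 1 1 d := fun d hd =>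
    isOfHodgeType_of_mem_algebraicClasses_of_isSmoothProjective hX 1 hd
  -- `SpannedByIsometries` applied to `f = πT F πT`
  obtain ⟨k, cc, g, hg, hfsum⟩ := hSp (πT ∘ₗ F ∘ₗ πT)
    (fun y hy => by rw [LinearMap.comp_apply, LinearMap.comp_apply]; exact hfrat y hy)
    (fun i j y hy => by rw [LinearMap.comp_apply, LinearMap.comp_apply]; exact hfh i j y hy)
    (fun d hd => by rw [LinearMap.comp_apply, LinearMap.comp_apply]; exact hfN d hd)
    (fun y d hd => by rw [LinearMap.comp_apply, LinearMap.comp_apply]; exact hfT y d hd)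
  have hfy : ∀ y, πT (F (πT y)) = ∑ i, (cc i : ℂ) • g i (πT y) := fun y => by
    have := hfsum (πT y) (hT3 y)
    rwa [LinearMap.comp_apply, LinearMap.comp_apply, hT2 (πT y) (hT3 y)] at this
  -- the `gᵢ` preserve `N¹(X)` (Lefschetz `(1,1)`)
  have hgN : ∀ i, ∀ d ∈ algebraicClasses X 1, g i d ∈ algebraicClasses X 1 := by
    have hspan := supportedClasses_eq_span_isRationalClass hX 2 1
    change algebraicClasses X 1 = Submodule.span ℂ
      {c : complexBetti X 2 | IsRationalClass c ∧ c ∈ algebraicClasses X 1} at hspan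
    intro i d hd
    rw [hspan] at hd
    have hle : Submodule.span ℂ {c : complexBetti X 2 | IsRationalClass c ∧ c ∈ algebraicClasses X 1} ≤
        (algebraicClasses X 1).comap (g i) := by
      refine Submodule.span_le.2 ?_
      rintro d ⟨hdrat, hdalg⟩
      exact lefschetzOneOne_rational_holds hX _ ((hg i).2.1 _ hdrat) ((hg i).2.2.1 1 1 _ (hN11 d hdalg))
    exact hle hd
  -- bilinear bookkeeping
  set qXform : LinearMap.BilinForm ℂ (complexBetti X 2) :=
    (Matrix.toBilin' (Matrix.map (k3HilbertGram 2) (Int.cast : ℤ → ℂ))).compl₁₂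
      (φ : complexBetti X 2 →ₗ[ℂ] (K3HilbertIndex → ℂ)) (φ : complexBetti X 2 →ₗ[ℂ] (K3HilbertIndex → ℂ))
    with hqXform
  have hqXapp : ∀ y w, qXform y w = k3HilbertForm 2 (φ y) (φ w) := fun y w => by
    rw [hqXform, LinearMap.compl₁₂_apply, qC_apply]; rfl
  have hqsub : ∀ a b w : complexBetti X 2, k3HilbertForm 2 (φ (a - b)) (φ w) =
      k3HilbertForm 2 (φ a) (φ w) - k3HilbertForm 2 (φ b) (φ w) := fun a b w => by
    rw [← hqXapp, ← hqXapp, ← hqXapp, map_sub, LinearMap.sub_apply]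
  -- `q(gᵢ (πT y), w) = q(gᵢ y, w) − q(gᵢ y_N, w_N)`
  have hgsplit : ∀ i y w, k3HilbertForm 2 (φ (g i (πT y))) (φ w) =
      k3HilbertForm 2 (φ (g i y)) (φ w) - k3HilbertForm 2 (φ (g i (y - πT y))) (φ (w - πT w)) := by
    intro i y w
    have e1 : g i (πT y) = g i y - g i (y - πT y) := by rw [map_sub]; abel
    have hw : w = (w - πT w) + πT w := by abel
    have e2 : k3HilbertForm 2 (φ (g i (y - πT y))) (φ w) =
        k3HilbertForm 2 (φ (g i (y - πT y))) (φ (w - πT w)) := by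
      conv_lhs => rw [hw, map_add, k3HilbertForm_add_right, hNT _ (hgN i _ (hT4 y)) w, add_zero]
    rw [e1, hqsub, e2]
  -- `q(f y, w) = Σ cᵢ (q(gᵢ y, w) − q(gᵢ y_N, w_N))`
  have hqf : ∀ y w, k3HilbertForm 2 (φ (πT (F (πT y)))) (φ w) = ∑ i, (cc i : ℂ) *
      (k3HilbertForm 2 (φ (g i y)) (φ w) - k3HilbertForm 2 (φ (g i (y - πT y))) (φ (w - πT w))) := by
    intro y w
    rw [← hqXapp, hfy, map_sum, LinearMap.sum_apply]
    refine Finset.sum_congr rfl fun i _ => ?_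
    rw [map_smul, LinearMap.smul_apply, smul_eq_mul, hqXapp, hgsplit]
  -- the symmetric correction form `β` on `N¹(X)`
  set B : complexBetti X 2 →ₗ[ℂ] complexBetti X 2 →ₗ[ℂ] ℂ :=
    qXform.compl₁₂ F LinearMap.id - ∑ i, (cc i : ℂ) • qXform.compl₁₂ (g i) LinearMap.id with hBraw
  have hBdef : ∀ u v, B u v = k3HilbertForm 2 (φ (F u)) (φ v) -
      ∑ i, (cc i : ℂ) * k3HilbertForm 2 (φ (g i u)) (φ v) := by
    intro u v
    rw [hBraw, LinearMap.sub_apply, LinearMap.sub_apply, LinearMap.compl₁₂_apply, LinearMap.id_apply, hqXapp,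
      LinearMap.sum_apply, LinearMap.sum_apply]
    congr 1
    refine Finset.sum_congr rfl fun i _ => ?_
    rw [LinearMap.smul_apply, LinearMap.smul_apply, LinearMap.compl₁₂_apply, LinearMap.id_apply, hqXapp,
      smul_eq_mul]
  clear_value B
  set β : complexBetti X 2 →ₗ[ℂ] complexBetti X 2 →ₗ[ℂ] ℂ := (1 / 2 : ℂ) • (B + B.flip) with hβraw
  have hβdef : ∀ u v, β u v = 1 / 2 * (B u v + B v u) := fun u v => by
    rw [hβraw, LinearMap.smul_apply, LinearMap.smul_apply, LinearMap.add_apply, LinearMap.add_apply,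
      LinearMap.flip_apply, smul_eq_mul]
  clear_value β
  have hβsymm : ∀ u v, β u v = β v u := fun u v => by rw [hβdef, hβdef, add_comm]
  have hqr : ∀ n ∈ algebraicClasses X 1, ∀ y : complexBetti X 2,
      k3HilbertForm 2 (φ n) (φ (y - πT y)) = k3HilbertForm 2 (φ n) (φ y) := by
    intro n hn y
    rw [map_sub, sub_eq_add_neg, k3HilbertForm_add_right, ← neg_one_smul ℂ, k3HilbertForm_smul_right,
      hNT n hn y, mul_zero, add_zero]
  -- the graph classes and the candidate
  choose cg hcgalg t hcg using fun i => hGraph (g i) (hg i).1 (hg i).2.1 (hg i).2.2.1 (hg i).2.2.2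
  obtain ⟨c', hc'alg, hc'⟩ := exists_algebraicClass_of_symmetricForm hO hcup hX hK hM
    (-(∑ i, (cc i : ℂ) / 2 * t i)) β hβsymm (fun y => y - πT y) hT4 hqr
  obtain ⟨c'', hc''def⟩ : ∃ c'' : complexBetti X (2 * 2), c'' = (∑ i, ((cc i : ℂ) / 2) • cg i) + c' :=
    ⟨_, rfl⟩
  have hc''alg : c'' ∈ algebraicClasses X 2 := by
    rw [hc''def]
    exact Submodule.add_mem _ (Submodule.sum_mem _ fun i _ => Submodule.smul_mem _ _ (hcgalg i)) hc'alg
  have hcup3 : ∀ y w : complexBetti X 2, Cup3[c, y, w] = Cup3[c'', y, w] := by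
    intro y w
    have hL1 : ∀ A A' : complexBetti X (2 * 2), Cup3[A + A', y, w] = Cup3[A, y, w] + Cup3[A', y, w] := by
      intro A A'; simp only [map_add, LinearMap.add_apply]
    have hL2 : ∀ (u : ℂ) (A : complexBetti X (2 * 2)), Cup3[u • A, y, w] = u • Cup3[A, y, w] := by
      intro u A; simp only [map_smul, LinearMap.smul_apply]
    have hL3 : ∀ A : Fin k → complexBetti X (2 * 2), Cup3[∑ i, A i, y, w] = ∑ i, Cup3[A i, y, w] := by
      intro A; simp only [map_sum, LinearMap.sum_apply]
    have hrhs : Cup3[c'', y, w] = ((∑ i, (cc i : ℂ) / 2 * (t i * k3HilbertForm 2 (φ y) (φ w) +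
        k3HilbertForm 2 (φ (g i y)) (φ w) + k3HilbertForm 2 (φ (g i w)) (φ y))) +
        (-(∑ i, (cc i : ℂ) / 2 * t i) * k3HilbertForm 2 (φ y) (φ w) + β (y - πT y) (w - πT w))) • P := by
      rw [hc''def, hL1, hL3, hc']
      conv_rhs => rw [add_smul, Finset.sum_smul]
      congr 1
      refine Finset.sum_congr rfl fun i _ => ?_
      rw [hL2, hcg, smul_smul]
    rw [hF, hrhs]
    congr 1
    -- the scalar identity, on the atoms `SA, SB, SAN, SBN, ST, q(y,w), q(F y_N, w_N)`
    have h1 : ∑ i, (cc i : ℂ) / 2 * (t i * k3HilbertForm 2 (φ y) (φ w) +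
        k3HilbertForm 2 (φ (g i y)) (φ w) + k3HilbertForm 2 (φ (g i w)) (φ y)) =
        (∑ i, (cc i : ℂ) / 2 * t i) * k3HilbertForm 2 (φ y) (φ w) +
          1 / 2 * ∑ i, (cc i : ℂ) * k3HilbertForm 2 (φ (g i y)) (φ w) +
          1 / 2 * ∑ i, (cc i : ℂ) * k3HilbertForm 2 (φ (g i w)) (φ y) := by
      rw [Finset.sum_mul, Finset.mul_sum, Finset.mul_sum, ← Finset.sum_add_distrib, ← Finset.sum_add_distrib]
      exact Finset.sum_congr rfl fun i _ => by ring
    have h2 : ∀ u v : complexBetti X 2, ∑ i, (cc i : ℂ) * (k3HilbertForm 2 (φ (g i u)) (φ v) -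
        k3HilbertForm 2 (φ (g i (u - πT u))) (φ (v - πT v))) =
        ∑ i, (cc i : ℂ) * k3HilbertForm 2 (φ (g i u)) (φ v) -
          ∑ i, (cc i : ℂ) * k3HilbertForm 2 (φ (g i (u - πT u))) (φ (v - πT v)) := fun u v => by
      rw [← Finset.sum_sub_distrib]
      exact Finset.sum_congr rfl fun i _ => by ring
    have hfw : k3HilbertForm 2 (φ (πT (F (πT w)))) (φ y) = k3HilbertForm 2 (φ (πT (F (πT y)))) (φ w) := by
      rw [hfadj w y, k3HilbertForm_comm]
    have key : k3HilbertForm 2 (φ (πT (F (πT y)))) (φ w) =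
        1 / 2 * (∑ i, (cc i : ℂ) * k3HilbertForm 2 (φ (g i y)) (φ w) -
          ∑ i, (cc i : ℂ) * k3HilbertForm 2 (φ (g i (y - πT y))) (φ (w - πT w))) +
        1 / 2 * (∑ i, (cc i : ℂ) * k3HilbertForm 2 (φ (g i w)) (φ y) -
          ∑ i, (cc i : ℂ) * k3HilbertForm 2 (φ (g i (w - πT w))) (φ (y - πT y))) := by
      rw [← h2, ← h2, ← hqf y w, ← hqf w y, hfw]; ring
    have hQF : k3HilbertForm 2 (φ (F (w - πT w))) (φ (y - πT y)) =
        k3HilbertForm 2 (φ (F (y - πT y))) (φ (w - πT w)) := by rw [hFadj, k3HilbertForm_comm]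
    rw [hsplitF y w, key, h1, hβdef, hBdef, hBdef, hQF]
    ring
  exact eq_of_cup3_eq hV hX hK hcup3 ▸ hc''alg

/-- **`IsometrySpannedThird` at EVERY Picard rank, partner-free, modulo the graph classes**: for a marked smooth
projective `K3^{[2]}`-type fourfold with `SpannedByIsometries X φ`, granted `Graph[X, φ, P]`, HC⁴(X) holds in
every degree (degree `4` above; the others by Lefschetz `(1,1)` and hard Lefschetz); modulo {Verbitsky–Guan,
O'Grady, Voisin}. [cite: Markman2024, §1.1 Thm. 1.1] [cite: Zarhin1983HodgeGroupsK3, Thm. 1.5.1]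
[cite: VoisinHodgeI2002, Thm. 11.30 and Thm. 6.25] -/
theorem hodgeConjectureFor_of_spannedByIsometries_of_graphClasses
    (hV : VerbitskyGuan_cohomology_K3HilbertSquareType) (hO : OGrady2008_dualBBFClass_algebraic)
    (hcup : Voisin2003_cupProduct_algebraicClasses)
    (hX : IsSmoothProjective 4 X) (hK : IsOfK3HilbertSquareType X) (hM : MarkedK3Sq[X, φ, P, z])
    (hSp : SpannedByIso[X, φ]) (hGraph : Graph[X, φ, P]) : HodgeConjectureFor 4 X :=
  ⟨nonempty_hodgeModel_holds hX, fun p c hc hH ↦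
    hodgeClasses_algebraic_fourfold_of_hodgeTwoTwo lefschetzOneOne_rational_holds
      (nonempty_hardLefschetzNFold_holds 4 X) hX
      (fun _ hc' hH' ↦ mem_algebraicClasses_two_of_spannedByIsometries_of_graphClasses hV hO hcup hX hK hM
        hSp hGraph hc' hH')
      p c hc hH⟩

end Summit.HodgeConjecture.HodgeConjecture.Theorems.MarkmanPartnerTransport.PartnerLattice

end
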